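import Literature.Analysis.FluidPDE.LuoTitiPerturbation
import Literature.Analysis.FluidPDE.FractionalNSReynolds
import Mathlib.Tactic.Module
import Mathlib.Tactic.LinearCombination
import HarnessLib

/-!
# Luo–Titi's perturbation: the Reynolds-stress identity `(⋆_ψ)` on `ℝ × 𝕋³`
  (Luo–Titi 2020, §3.5: the display defining `R_{q+1}`)

Analysis/FluidPDE support file (everything proved; no named facts), sibling of
`LuoTitiPerturbation`, for the proof of the Iteration Lemma of T. Luo and E. S. Titi,
Calc. Var. PDE 59 (2020) = arXiv:1808.07595 (`Torus.LuoTiti2020_iterationLemma`). §3.5: "We obtain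
`R_{q+1}` by plugging `v_{q+1} = v_q + w_{q+1}` in (2.1), using (3.17) and the assumption that
`(v_q, R_q)` solves (2.1): `∇·R_{q+1} = ∇·[ℛ(ν(-Δ)^θ w_{q+1} + ∂ₜw^{(p)} + ∂ₜw^{(c)}) + v_q ⊗ w_{q+1} + w_{q+1} ⊗ v_q]
+ ∇·[(w^{(c)} + w^{(t)}) ⊗ w_{q+1} + w^{(p)} ⊗ (w^{(c)} + w^{(t)})] + [∇·(w^{(p)} ⊗ w^{(p)} - R_q) + ∂ₜw^{(t)}] + ∇(p_{q+1} - p_q)`".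
For the cut-off perturbation `w = ψ•wpc + ψ²•wt` of `LuoTiti.Setup` (built on the tree's
intermittent-jet step) this file proves the corresponding identity of fields on `ℝ × 𝕋³`:

* **`Setup.star_psi`** — `∂ₜw + div(w ⊗ w) + div R = div S_ψ + ∇q_ψ + f_ψ` at every `(t, y)`,
  with the data `Sψ, qψ, fψ` of `LuoTitiPerturbation`. Inside `tsupport ψ ⊂ (0, T)` it is
  `ψ²·(⋆)` — the jet identity `JetStep.Datum.star` taken with the carried stress
  `Rc = (tr R/3) Id` (so that `Rc + R̊ = R` and `div Rc = ∇(tr R/3)` is a pressure) — plus the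
  cut-off terms, using that `R = 0` wherever `ψ ≠ 1` (`(1-ψ²) div R = 0`); the polynomial
  bookkeeping in `ψ, ψ′` is a `linear_combination` in the module `ℝ³`. Outside `tsupport ψ`
  both sides vanish.
* `Setup.integral_fψ` — `∫ f_ψ(t) = 0` (integrate the identity: `∫∂ₜw = d/dt ∫w = 0`,
  `∫ div = 0`, `∫ ∇ = 0`), the zero-mean input of the abstract step
  `Torus.IsFracNSReynoldsOn.perturb_univ` (`FluidPDE/FractionalNSReynoldsPerturb`).

## References

* T. Luo, E. S. Titi, Calc. Var. PDE 59 (2020) = arXiv:1808.07595, §3.5 (the display defining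
  `R_{q+1}`; "Hence `∫ ν(-Δ)^θ w_{q+1} dx = 0` and `∫ w_{q+1} dx = 0`"). [`LuoTiti2020`]
* T. Buckmaster, V. Vicol, EMS Surv. Math. Sci. 6 (2019) = arXiv:1901.09023, §7.6 (7.47)–(7.59).
  [`BuckmasterVicol2020`]
-/

noncomputable section

open MeasureTheory Set Filter Topology Function UnitAddTorus
open scoped InnerProductSpace ContDiff ENNReal

namespace Literature.Analysis.FluidPDE

namespace LuoTiti

open Literature.Analysis.FunctionSpaces FunctionSpaces.Torus Mikado NashGeometric Jet JetStep

/-- Notation: the three-torus and its tangent space. -/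
local notation "𝕋³" => UnitAddTorus (Fin 3)
local notation "E³" => EuclideanSpace ℝ (Fin 3)

namespace Setup

variable {S : Setup} (h : S.Valid)
include h

/-! ### The Reynolds-stress identity `(⋆_ψ)` -/

/-- `(1 - ψ²) div R = 0`: the stress vanishes wherever `ψ ≠ 1`. [folklore] -/
theorem sq_smul_tensorDivergence_M (t : ℝ) (y : 𝕋³) :
    (S.ψ t) ^ 2 • Torus.tensorDivergence (S.D.M t) y = Torus.tensorDivergence (S.D.M t) y := by
  rcases h.hψM t with h1 | h0
  · rw [h1]; simp
  · have : Torus.tensorDivergence (S.D.M t) y = 0 := by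
      rw [h0]; exact Torus.tensorDivergence_zero y
    rw [this, smul_zero]

omit h in
/-- Bilinear expansion of `u ⊗ u` for `u = a•A + b•B` (pointwise). [folklore] -/
theorem tensorProd_smul_add_smul (a b : ℝ) (A B : 𝕋³ → E³) :
    Torus.tensorProd (fun z => a • A z + b • B z) (fun z => a • A z + b • B z) = fun z j =>
      a ^ 2 • Torus.tensorProd A A z j + (a * b) • (Torus.tensorProd A B z j + Torus.tensorProd B A z j) +
        b ^ 2 • Torus.tensorProd B B z j := by
  funext z j
  simp only [Torus.tensorProd, PiLp.add_apply, PiLp.smul_apply, smul_eq_mul]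
  module

omit h in
/-- Unfolding `w` at a time. [folklore] -/
theorem w_apply (t : ℝ) : S.w t = fun z => S.ψ t • S.D.wpc t z + (S.ψ t) ^ 2 • wt S.D t z := rfl

/-- **The Reynolds-stress identity of Luo–Titi's perturbation on `ℝ × 𝕋³`**:
`∂ₜw + div(w ⊗ w) + div R = div S_ψ + ∇q_ψ + f_ψ` at every `(t, y)`. Inside `tsupport ψ` this
is `ψ²·(⋆)` (`JetStep.Datum.star` with carried stress `Rc = (tr R/3) Id`) plus the cut-off terms;
outside, both sides vanish. [cite: LuoTiti2020, §3.5 (the display defining `R_{q+1}`)] -/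
theorem star_psi (t : ℝ) (y : 𝕋³) :
    Torus.timeDeriv S.w t y + Torus.tensorDivergence (Torus.tensorProd (S.w t) (S.w t)) y + Torus.tensorDivergence (S.D.M t) y =
      Torus.tensorDivergence (S.Sψ t) y + Torus.gradient (S.qψ t) y + S.fψ t y := by
  have hD := h.hD
  by_cases ht : t ∈ tsupport S.ψ
  swap
  · -- outside the support everything vanishes
    obtain ⟨hw0, -, -, hS0, hq0, hf0⟩ := eq_zero_of_not_mem (S := S) ht
    have hdt : Torus.timeDeriv S.w t y = 0 := by
      have e : S.w = fun t y => S.ψ t • (fun t y => S.D.wpc t y + S.ψ t • wt S.D t y) t y := by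
        funext s z; simp only [w, smul_add, smul_smul, pow_two]
      rw [e]; exact Torus.timeDeriv_cutoff_of_not_mem ht y
    rw [hdt, hw0, hS0, hq0, hf0, M_eq_zero h ht]
    have h1 : Torus.tensorProd (0 : 𝕋³ → E³) 0 = fun _ _ => 0 := by funext z j; simp [Torus.tensorProd]
    rw [h1, Torus.tensorDivergence_zero, show (0 : 𝕋³ → Fin 3 → E³) = fun _ _ => 0 from rfl, Torus.tensorDivergence_zero,
      show (0 : 𝕋³ → ℝ) = fun _ => 0 from rfl, Torus.gradient_zero]
    simp
  -- inside the support: `t ∈ (0, T)`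
  have htO : t ∈ Ioo 0 S.D.T := h.hψsupp ht
  have htI : t ∈ Icc 0 S.D.T := Ioo_subset_Icc_self htO
  -- smoothness at time `t`
  have hA : Torus.IsSmooth (S.D.wpc t) := (Datum.smooth_wpc hD).isSmooth_slice htI
  have hB : Torus.IsSmooth (wt S.D t) := (smooth_wt h).isSmooth_slice htI
  have hX : Torus.IsSmooth (S.D.X t) := (Datum.smooth_X hD).isSmooth_slice htI
  have hζ : Torus.IsSmooth (S.D.zeta t) := (Datum.smooth_zeta hD).isSmooth_slice htI
  have hq : Torus.IsSmooth (S.D.qfun t) := (Datum.smooth_qfun hD).isSmooth_slice htI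
  have hM : Torus.IsSmooth (S.D.M t) := hD.hM.isSmooth_slice htI
  have htr : Torus.IsSmooth (fun z => Torus.tensorTrace (S.D.M t) z / 3) := hM.tensorTrace.div_const _
  have hcr : Torus.IsSmooth (S.D.cross t) := Datum.isSmooth_cross hD htI
  have hso : Torus.IsSmooth (S.D.Sosc t) := Datum.isSmooth_Sosc hD htI
  have hRc : Torus.IsSmooth (Rc S.D t) := (smooth_Rc h).isSmooth_slice htI
  have c1 : ∀ {F : Type} [NormedAddCommGroup F] [NormedSpace ℝ F] {f : 𝕋³ → F}, Torus.IsSmooth f → Torus.IsContDiff 1 f :=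
    fun hf => hf.isContDiff (by simp)
  -- the tensor atoms
  have hAA : Torus.IsSmooth (Torus.tensorProd (S.D.wpc t) (S.D.wpc t)) := hA.tensorProd hA
  have hAB : Torus.IsSmooth (fun z j => Torus.tensorProd (S.D.wpc t) (wt S.D t) z j + Torus.tensorProd (wt S.D t) (S.D.wpc t) z j) :=
    (hA.tensorProd hB).add (hB.tensorProd hA)
  have hBB : Torus.IsSmooth (Torus.tensorProd (wt S.D t) (wt S.D t)) := hB.tensorProd hB
  set ψ₀ := S.ψ t with hψ₀
  set ψ₁ := deriv S.ψ t with hψ₁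
  -- (1) the time derivative
  have e1 := timeDeriv_w_of_mem h htO y
  rw [timeDerivWithin_wt h htI y] at e1
  -- (2) `div (w ⊗ w)`
  have e2 : Torus.tensorDivergence (Torus.tensorProd (S.w t) (S.w t)) y =
      ψ₀ ^ 2 • Torus.tensorDivergence (Torus.tensorProd (S.D.wpc t) (S.D.wpc t)) y +
      (ψ₀ * ψ₀ ^ 2) • Torus.tensorDivergence (fun z j => Torus.tensorProd (S.D.wpc t) (wt S.D t) z j + Torus.tensorProd (wt S.D t) (S.D.wpc t) z j) y +
      (ψ₀ ^ 2) ^ 2 • Torus.tensorDivergence (Torus.tensorProd (wt S.D t) (wt S.D t)) y := by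
    rw [w_apply, tensorProd_smul_add_smul]
    have k1 : Torus.IsContDiff 1 (fun z j => ψ₀ ^ 2 • Torus.tensorProd (S.D.wpc t) (S.D.wpc t) z j) := c1 (hAA.smul _)
    have k2 : Torus.IsContDiff 1 (fun z j => (ψ₀ * ψ₀ ^ 2) • (Torus.tensorProd (S.D.wpc t) (wt S.D t) z j + Torus.tensorProd (wt S.D t) (S.D.wpc t) z j)) :=
      c1 (hAB.smul _)
    have k3 : Torus.IsContDiff 1 (fun z j => (ψ₀ ^ 2) ^ 2 • Torus.tensorProd (wt S.D t) (wt S.D t) z j) := c1 (hBB.smul _)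
    have k12 : Torus.IsContDiff 1 (fun z j => ψ₀ ^ 2 • Torus.tensorProd (S.D.wpc t) (S.D.wpc t) z j +
        (ψ₀ * ψ₀ ^ 2) • (Torus.tensorProd (S.D.wpc t) (wt S.D t) z j + Torus.tensorProd (wt S.D t) (S.D.wpc t) z j)) := k1.add k2
    rw [Torus.tensorDivergence_add_apply k12 k3, Torus.tensorDivergence_add_apply k1 k2,
      Torus.tensorDivergence_const_smul_apply (c1 hAA), Torus.tensorDivergence_const_smul_apply (c1 hAB),
      Torus.tensorDivergence_const_smul_apply (c1 hBB)]
  -- (3) `div S_ψ`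
  have e3 : Torus.tensorDivergence (S.Sψ t) y =
      ψ₀ ^ 2 • (Torus.tensorDivergence (S.D.cross t) y + Torus.tensorDivergence (S.D.Sosc t) y) +
      (ψ₀ ^ 3 - ψ₀ ^ 2) • Torus.tensorDivergence (fun z j => Torus.tensorProd (S.D.wpc t) (wt S.D t) z j + Torus.tensorProd (wt S.D t) (S.D.wpc t) z j) y +
      (ψ₀ ^ 4 - ψ₀ ^ 2) • Torus.tensorDivergence (Torus.tensorProd (wt S.D t) (wt S.D t)) y := by
    have hcs : Torus.IsSmooth (fun z j => S.D.cross t z j + S.D.Sosc t z j) := hcr.add hso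
    have k1 : Torus.IsContDiff 1 (fun z j => ψ₀ ^ 2 • (S.D.cross t z j + S.D.Sosc t z j)) := c1 (hcs.smul _)
    have k2 : Torus.IsContDiff 1 (fun z j => (ψ₀ ^ 3 - ψ₀ ^ 2) • (Torus.tensorProd (S.D.wpc t) (wt S.D t) z j + Torus.tensorProd (wt S.D t) (S.D.wpc t) z j)) :=
      c1 (hAB.smul _)
    have k3 : Torus.IsContDiff 1 (fun z j => (ψ₀ ^ 4 - ψ₀ ^ 2) • Torus.tensorProd (wt S.D t) (wt S.D t) z j) := c1 (hBB.smul _)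
    have k12 : Torus.IsContDiff 1 (fun z j => ψ₀ ^ 2 • (S.D.cross t z j + S.D.Sosc t z j) +
        (ψ₀ ^ 3 - ψ₀ ^ 2) • (Torus.tensorProd (S.D.wpc t) (wt S.D t) z j + Torus.tensorProd (wt S.D t) (S.D.wpc t) z j)) := k1.add k2
    rw [show S.Sψ t = fun z j => ψ₀ ^ 2 • (S.D.cross t z j + S.D.Sosc t z j) +
        (ψ₀ ^ 3 - ψ₀ ^ 2) • (Torus.tensorProd (S.D.wpc t) (wt S.D t) z j + Torus.tensorProd (wt S.D t) (S.D.wpc t) z j) +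
        (ψ₀ ^ 4 - ψ₀ ^ 2) • Torus.tensorProd (wt S.D t) (wt S.D t) z j from rfl,
      Torus.tensorDivergence_add_apply k12 k3, Torus.tensorDivergence_add_apply k1 k2,
      Torus.tensorDivergence_const_smul_apply (c1 hcs), Torus.tensorDivergence_const_smul_apply (c1 hAB),
      Torus.tensorDivergence_const_smul_apply (c1 hBB), Torus.tensorDivergence_add_apply (c1 hcr) (c1 hso)]
  -- (4) `∇q_ψ`
  have e4 : Torus.gradient (S.qψ t) y = ψ₀ ^ 2 • (Torus.gradient (S.D.qfun t) y + Torus.gradient (fun z => Torus.tensorTrace (S.D.M t) z / 3) y) +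
      (2 * ψ₀ * ψ₁) • Torus.gradient (S.D.zeta t) y := by
    have hqt : Torus.IsSmooth (fun z => S.D.qfun t z + Torus.tensorTrace (S.D.M t) z / 3) := hq.add htr
    have k1 : Torus.IsContDiff 1 (fun z => ψ₀ ^ 2 * (S.D.qfun t z + Torus.tensorTrace (S.D.M t) z / 3)) := c1 ((Torus.isSmooth_const _).mul hqt)
    have k2 : Torus.IsContDiff 1 (fun z => 2 * ψ₀ * ψ₁ * S.D.zeta t z) := c1 ((Torus.isSmooth_const _).mul hζ)
    rw [show S.qψ t = fun z => ψ₀ ^ 2 * (S.D.qfun t z + Torus.tensorTrace (S.D.M t) z / 3) + 2 * ψ₀ * ψ₁ * S.D.zeta t z from rfl,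
      Torus.gradient_add_apply k1 k2, Torus.gradient_const_mul_apply (c1 hqt), Torus.gradient_const_mul_apply (c1 hζ),
      Torus.gradient_add_apply (c1 hq) (c1 htr)]
  -- (5) the jet identity `(⋆)` with `Rc = (tr R/3) Id`
  have hst := Datum.star hD (smooth_Rc h) htI y
  rw [Datum.timeDerivWithin_w hD htI y] at hst
  have eM : (fun z j => Rc S.D t z j + Torus.traceless (S.D.M t) z j) = S.D.M t := by
    funext z j; exact Rc_add_traceless S.D t z j
  rw [eM] at hst
  have eww : Torus.tensorDivergence (Torus.tensorProd (S.D.w t) (S.D.w t)) y =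
      Torus.tensorDivergence (Torus.tensorProd (S.D.wpc t) (S.D.wpc t)) y +
      Torus.tensorDivergence (fun z j => Torus.tensorProd (S.D.wpc t) (wt S.D t) z j + Torus.tensorProd (wt S.D t) (S.D.wpc t) z j) y +
      Torus.tensorDivergence (Torus.tensorProd (wt S.D t) (wt S.D t)) y := by
    have ewD : S.D.w t = fun z => (1 : ℝ) • S.D.wpc t z + (1 : ℝ) • wt S.D t z := by
      funext z; rw [one_smul, one_smul]; exact w_D_eq S.D t z
    rw [ewD, tensorProd_smul_add_smul]
    simp only [one_pow, one_mul, one_smul]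
    have k12 : Torus.IsContDiff 1 (fun z j => Torus.tensorProd (S.D.wpc t) (S.D.wpc t) z j +
        (Torus.tensorProd (S.D.wpc t) (wt S.D t) z j + Torus.tensorProd (wt S.D t) (S.D.wpc t) z j)) := c1 (hAA.add hAB)
    rw [Torus.tensorDivergence_add_apply k12 (c1 hBB), Torus.tensorDivergence_add_apply (c1 hAA) (c1 hAB)]
  rw [eww] at hst
  have eS1 : Torus.tensorDivergence (S.D.S₁ (Rc S.D) t) y = Torus.gradient (fun z => Torus.tensorTrace (S.D.M t) z / 3) y +
      Torus.tensorDivergence (S.D.cross t) y + Torus.tensorDivergence (S.D.Sosc t) y := by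
    have k12 : Torus.IsContDiff 1 (fun z j => Rc S.D t z j + S.D.cross t z j) := c1 (hRc.add hcr)
    rw [show S.D.S₁ (Rc S.D) t = fun z j => (Rc S.D t z j + S.D.cross t z j) + S.D.Sosc t z j from rfl,
      Torus.tensorDivergence_add_apply k12 (c1 hso), Torus.tensorDivergence_add_apply (c1 hRc) (c1 hcr),
      show Rc S.D t = fun z j => (Torus.tensorTrace (S.D.M t) z / 3) • EuclideanSpace.single j (1 : ℝ) from rfl,
      Torus.tensorDivergence_smul_single (c1 htr)]
  rw [eS1] at hst
  -- (6) assemble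
  have hM2 := sq_smul_tensorDivergence_M h t y
  have h2 : ((1 : ℝ) - ψ₀ ^ 2) • Torus.tensorDivergence (S.D.M t) y = 0 := by
    rw [sub_smul, one_smul, hM2, sub_self]
  rw [show wt S.D t y = S.D.X t y + Torus.gradient (S.D.zeta t) y from rfl] at e1
  rw [e1, e2, e3, e4]
  simp only [fψ, ← hψ₀, ← hψ₁] at hst ⊢
  linear_combination (norm := module) ψ₀ ^ 2 • hst + h2

/-- **`∫ f_ψ(t) = 0`** at every time (integrate `(⋆_ψ)`: time derivatives of zero-mean fields,
divergences and gradients have zero integral). [cite: LuoTiti2020, §3.5] -/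
theorem integral_fψ (t : ℝ) : ∫ y, S.fψ t y = 0 := by
  have hD := h.hD
  by_cases ht : t ∈ tsupport S.ψ
  swap
  · rw [(eq_zero_of_not_mem (S := S) ht).2.2.2.2.2]; simp
  have htI : t ∈ Icc 0 S.D.T := tsupport_subset_Icc h ht
  have hwt : Torus.IsSmooth (S.w t) := (smooth_w h).isSmooth_slice (mem_univ t)
  have hMt : Torus.IsSmooth (S.D.M t) := hD.hM.isSmooth_slice htI
  have hSt : Torus.IsSmooth (S.Sψ t) := (smooth_Sψ h).isSmooth_slice (mem_univ t)
  have hqt : Torus.IsSmooth (S.qψ t) := (smooth_qψ h).isSmooth_slice (mem_univ t)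
  have heq : ∀ y, S.fψ t y = (Torus.timeDeriv S.w t y + Torus.tensorDivergence (Torus.tensorProd (S.w t) (S.w t)) y +
      Torus.tensorDivergence (S.D.M t) y - Torus.tensorDivergence (S.Sψ t) y) - Torus.gradient (S.qψ t) y := by
    intro y; rw [star_psi h t y]; abel
  have hdt : Torus.IsSmooth (Torus.timeDeriv S.w t) := by
    have := ((smooth_w h).timeDerivWithin uniqueDiffOn_univ).isSmooth_slice (mem_univ t)
    rwa [Torus.timeDerivWithin_univ] at this
  have i1 : Integrable (fun y => Torus.timeDeriv S.w t y) volume := hdt.integrable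
  have i2 : Integrable (fun y => Torus.tensorDivergence (Torus.tensorProd (S.w t) (S.w t)) y) volume := (hwt.tensorProd hwt).tensorDivergence.integrable
  have i3 : Integrable (fun y => Torus.tensorDivergence (S.D.M t) y) volume := hMt.tensorDivergence.integrable
  have i4 : Integrable (fun y => Torus.tensorDivergence (S.Sψ t) y) volume := hSt.tensorDivergence.integrable
  have i5 : Integrable (fun y => Torus.gradient (S.qψ t) y) volume := hqt.gradient.integrable
  have i12 : Integrable (fun y => Torus.timeDeriv S.w t y + Torus.tensorDivergence (Torus.tensorProd (S.w t) (S.w t)) y) volume := i1.add i2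
  have i123 : Integrable (fun y => Torus.timeDeriv S.w t y + Torus.tensorDivergence (Torus.tensorProd (S.w t) (S.w t)) y +
      Torus.tensorDivergence (S.D.M t) y) volume := i12.add i3
  have i1234 : Integrable (fun y => Torus.timeDeriv S.w t y + Torus.tensorDivergence (Torus.tensorProd (S.w t) (S.w t)) y +
      Torus.tensorDivergence (S.D.M t) y - Torus.tensorDivergence (S.Sψ t) y) volume := i123.sub i4
  rw [integral_congr_ae (Eventually.of_forall heq), integral_sub i1234 i5, integral_sub i123 i4, integral_add i12 i3, integral_add i1 i2]
  have z1 : ∫ y, Torus.timeDeriv S.w t y = 0 := by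
    have h0 := Torus.hasZeroMean_timeDerivWithin_univ (smooth_w h) (fun s => integral_w h s) t
    unfold Torus.HasZeroMean at h0
    rw [Torus.timeDerivWithin_univ] at h0
    exact h0
  rw [z1, Torus.integral_tensorDivergence_eq_zero' (hwt.tensorProd hwt), Torus.integral_tensorDivergence_eq_zero' hMt,
    Torus.integral_tensorDivergence_eq_zero' hSt, Torus.integral_gradient_eq_zero hqt]
  simp

end Setup

end LuoTiti

end Literature.Analysis.FluidPDE
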